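import Summits.ResolutionOfSingularities.KangarooAtlas.MizutaniTowerModel
import Literature.LinearAlgebra.Matrix.RankMinors
import Mathlib.RingTheory.Localization.FractionRing
import Mathlib.RingTheory.Polynomial.Basic
import Mathlib.LinearAlgebra.Matrix.Rank
import HarnessLib

/-!
# Mizutani's conjecture `m(e) = 2p^e − 1` — the polynomial tower model, II: profile matrices

Cell topic `Summits/ResolutionOfSingularities/KangarooAtlas` (pub-rosobs); namespace
`Summit.ResolutionOfSingularities.KangarooAtlas.Mizutani`.  Continuation of `MizutaniTowerModel`
(MIZUTANI-PROOF-g59 §1.4, the PROFILES `σ_i`).  In-house chain, AI-written; not a resolution theorem.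

* `Box ι q = ι → Fin q` — the finite index type of the box `[0, q−1]^ι`, `Box.toF` its exponent
  vector, `Box.deg` the degree `|T|`.
* `hsMatrix e q n ω` — the HS MATRIX of `ω`: rows `T ∈ Box` with `|T| ≤ n`, columns `M ∈ Box`,
  entry `coeff_{t^M} ((D^{(T)} ⊗ 1) ω) ∈ F[a]` (the coordinates of `(D^{(T)}⊗1)ω` in the left
  `t`-basis; MIZUTANI-PROOF-g59 §1.4 uses the right basis `1 ⊗ a^U` — same row space dimension).
* `profile e q n ω` — its rank over `Frac F[a]`; this is `≤ σ^L_n(ω)` of §1.4 (the span of ALL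
  `(D ⊗ 1)ω`, `D ∈ Diff^n`, contains these rows), which is the only direction the chain uses.
* `le_profile_iff` — `r ≤ profile` iff some `r × r` minor of the HS matrix is a non-zero
  polynomial (the form in which semicontinuity, automorphism invariance and base change are proved);
  `profile_eq_of_map` — entrywise images under an injective ring map have the same profile.
* **`card_le_profile_monomial`** (§1.4 MONOMIALS, lower bound): for a constant `c ≠ 0`,
  `profile_n(c · t^N) ≥ #{T ∈ Box : C(N,T) ≠ 0 in F, |T| ≤ n}` — the rows `T` with `C(N,T) ≠ 0`
  carry the single entry `C(N,T) c` in the distinct columns `N − T`.  (With Lucas, `C(N,T) ≠ 0 in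
  F ⟺ T ≤_d N` digitwise in base `p = char F`; that dictionary and the Digit Lemma live in the
  companion files.)

References: [Mizutani1973HironakaGroupSchemes] (Remark 2.10); [Oda1983HironakaGroupSchemeII]
(§1 p. 1166); [EGAIV4] Thm. 16.11.2.
-/

open MvPolynomial Literature.AlgebraicGeometry.Resolution

namespace Summit.ResolutionOfSingularities.KangarooAtlas.Mizutani

/-! ## The box as a finite index type -/

section Box

variable {ι : Type*}

/-- The box `[0, q−1]^ι` as a finite index type (rows / columns of the profile matrices).
[cite: Oda1983HironakaGroupSchemeII, §1 (p. 1166)] -/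
abbrev Box (ι : Type*) (q : ℕ) := ι → Fin q

/-- A box index as an exponent vector. [cite: Oda1983HironakaGroupSchemeII, §1 (p. 1166)] -/
noncomputable def Box.toF [Finite ι] {q : ℕ} (M : Box ι q) : ι →₀ ℕ :=
  Finsupp.equivFunOnFinite.symm fun i => (M i : ℕ)

/-- Components of `Box.toF`. [cite: Oda1983HironakaGroupSchemeII, §1 (p. 1166)] -/
@[simp] theorem Box.toF_apply [Finite ι] {q : ℕ} (M : Box ι q) (i : ι) : M.toF i = M i := by
  simp [Box.toF]

/-- A box index lies in the box. [cite: Oda1983HironakaGroupSchemeII, §1 (p. 1166)] -/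
theorem Box.inBox_toF [Finite ι] {q : ℕ} (M : Box ι q) : InBox q M.toF :=
  fun i => by rw [Box.toF_apply]; exact (M i).isLt

/-- `Box.toF` is injective. [cite: Oda1983HironakaGroupSchemeII, §1 (p. 1166)] -/
theorem Box.toF_injective [Finite ι] {q : ℕ} : Function.Injective (Box.toF (ι := ι) (q := q)) := by
  intro M N h
  funext i
  apply Fin.ext
  have := congrArg (fun f => f i) h
  simpa using this

/-- The box index of an exponent vector in the box. [cite: Oda1983HironakaGroupSchemeII, §1 (p. 1166)] -/
def Box.ofF {q : ℕ} (M : ι →₀ ℕ) (hM : InBox q M) : Box ι q := fun i => ⟨M i, hM i⟩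

/-- `Box.ofF` inverts `Box.toF`. [cite: Oda1983HironakaGroupSchemeII, §1 (p. 1166)] -/
@[simp] theorem Box.toF_ofF [Finite ι] {q : ℕ} (M : ι →₀ ℕ) (hM : InBox q M) :
    (Box.ofF M hM).toF = M := by
  ext i; simp [Box.ofF]

/-- The degree `|T| = Σ T_i` of a box index. [cite: Oda1983HironakaGroupSchemeII, §1 (p. 1166)] -/
def Box.deg [Fintype ι] {q : ℕ} (T : Box ι q) : ℕ := ∑ i, (T i : ℕ)

/-- `|T.toF| = T.deg`. [cite: Oda1983HironakaGroupSchemeII, §1 (p. 1166)] -/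
theorem Box.degree_toF [Fintype ι] {q : ℕ} (T : Box ι q) : T.toF.degree = T.deg := by
  classical
  unfold Box.deg
  rw [Finsupp.degree_eq_sum]
  simp

/-- If `T ≤ N` with `N` in the box then `N − T` is in the box. [folklore] -/
theorem inBox_tsub {q : ℕ} {N : ι →₀ ℕ} (hN : InBox q N) (T : ι →₀ ℕ) : InBox q (N - T) :=
  fun i => by rw [Finsupp.tsub_apply]; exact lt_of_le_of_lt (Nat.sub_le _ _) (hN i)

end Box

/-! ## The HS matrix and the profile -/

section Profile

variable {ι κ F : Type*} [Field F] [Fintype ι] [DecidableEq κ] (e : ι → κ) (q : ℕ)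

/-- **The HS matrix** of `ω` up to order `n`: rows the box indices `T` with `|T| ≤ n`, columns the
box indices `M`, entry `coeff_{t^M}((D^{(T)} ⊗ 1) ω) ∈ F[a]` (MIZUTANI-PROOF-g59 §1.4, in the left
`t`-basis). [cite: EGAIV4, Thm. 16.11.2 (the operators D^{(T)})] -/
noncomputable def hsMatrix (n : ℕ) (ω : Rel ι κ F) :
    Matrix {T : Box ι q // T.deg ≤ n} (Box ι q) (MvPolynomial κ F) :=
  fun T M => coeff M.toF (hsOp e T.1.toF ω)

/-- Entries of the HS matrix. [cite: EGAIV4, Thm. 16.11.2] -/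
theorem hsMatrix_apply (n : ℕ) (ω : Rel ι κ F) (T : {T : Box ι q // T.deg ≤ n}) (M : Box ι q) :
    hsMatrix e q n ω T M = coeff M.toF (hsOp e T.1.toF ω) := rfl

/-- The HS matrix is additive in `ω`. [cite: EGAIV4, Thm. 16.11.2] -/
theorem hsMatrix_add (n : ℕ) (ω ω' : Rel ι κ F) :
    hsMatrix e q n (ω + ω') = hsMatrix e q n ω + hsMatrix e q n ω' := by
  ext T M
  simp [hsMatrix_apply, hsOp_add]

variable [DecidableEq ι]

/-- **The profile `σ_n(ω)`** of the model (a lower bound for the `σ^L_n` of MIZUTANI-PROOF-g59 §1.4):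
the rank over `Frac F[a]` of the HS matrix of order `n`.
[cite: Mizutani1973HironakaGroupSchemes, Remark 2.10 (in-house proof, §1.4 profiles)] -/
noncomputable def profile (n : ℕ) (ω : Rel ι κ F) : ℕ :=
  ((hsMatrix e q n ω).map
    (algebraMap (MvPolynomial κ F) (FractionRing (MvPolynomial κ F)))).rank

/-! ### Rank through minors -/

/-- Over a domain mapped injectively into a field, a minor is non-zero iff its image is.
[folklore] -/
theorem det_submatrix_map_ne_zero_iff {A K : Type*} [CommRing A] [CommRing K] (f : A →+* K)
    (hf : Function.Injective f) {m n : Type*} {r : ℕ} (H : Matrix m n A)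
    (rows : Fin r → m) (cols : Fin r → n) :
    ((H.map f).submatrix rows cols).det ≠ 0 ↔ (H.submatrix rows cols).det ≠ 0 := by
  rw [Matrix.submatrix_map, ← RingHom.mapMatrix_apply, ← RingHom.map_det]
  exact (map_ne_zero_iff f hf)

/-- **Profile through minors**: `r ≤ σ_n(ω)` iff some `r × r` minor of the HS matrix is a non-zero
polynomial. [cite: Mizutani1973HironakaGroupSchemes, Remark 2.10 (in-house proof, §5 semicontinuity)] -/
theorem le_profile_iff (n r : ℕ) (ω : Rel ι κ F) :
    r ≤ profile e q n ω ↔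
      ∃ (rows : Fin r → {T : Box ι q // T.deg ≤ n}) (cols : Fin r → Box ι q),
        ((hsMatrix e q n ω).submatrix rows cols).det ≠ 0 := by
  unfold profile
  rw [Literature.LinearAlgebra.Matrix.le_rank_iff_exists_det_submatrix_ne_zero]
  refine exists_congr fun rows => exists_congr fun cols => ?_
  exact det_submatrix_map_ne_zero_iff _ (IsFractionRing.injective _ _) _ rows cols

/-- A general transfer principle: two matrices over domains whose entries correspond under an
injective ring map have the same rank over the respective fraction fields. [folklore] -/
theorem rank_map_fractionRing_eq_of_map {A A' : Type*} [CommRing A] [IsDomain A] [CommRing A']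
    [IsDomain A'] (f : A →+* A') (hf : Function.Injective f) {m n : Type*} [Fintype m] [Fintype n]
    (H : Matrix m n A) :
    ((H.map f).map (algebraMap A' (FractionRing A'))).rank =
      (H.map (algebraMap A (FractionRing A))).rank := by
  apply le_antisymm
  · by_contra hlt
    push Not at hlt
    obtain ⟨rows, cols, hne⟩ :=
      (Literature.LinearAlgebra.Matrix.le_rank_iff_exists_det_submatrix_ne_zero _).mp
        (Nat.succ_le_of_lt hlt)
    rw [det_submatrix_map_ne_zero_iff _ (IsFractionRing.injective _ _),
      det_submatrix_map_ne_zero_iff _ hf] at hne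
    have := (Literature.LinearAlgebra.Matrix.le_rank_iff_exists_det_submatrix_ne_zero _).mpr
      ⟨rows, cols, (det_submatrix_map_ne_zero_iff _ (IsFractionRing.injective A (FractionRing A))
        H rows cols).mpr hne⟩
    omega
  · by_contra hlt
    push Not at hlt
    obtain ⟨rows, cols, hne⟩ :=
      (Literature.LinearAlgebra.Matrix.le_rank_iff_exists_det_submatrix_ne_zero _).mp
        (Nat.succ_le_of_lt hlt)
    rw [det_submatrix_map_ne_zero_iff _ (IsFractionRing.injective _ _)] at hne
    have := (Literature.LinearAlgebra.Matrix.le_rank_iff_exists_det_submatrix_ne_zero _).mpr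
      ⟨rows, cols, (det_submatrix_map_ne_zero_iff _
        (IsFractionRing.injective A' (FractionRing A')) (H.map f) rows cols).mpr
          ((det_submatrix_map_ne_zero_iff f hf H rows cols).mpr hne)⟩
    omega

/-- **Base change / automorphism invariance pattern**: if the HS matrix of `ω'` (in a model with
coefficient variables `κ'`) is the entrywise image of that of `ω` under an injective ring map, the
profiles agree. [cite: Mizutani1973HironakaGroupSchemes, Remark 2.10 (in-house proof, §1.4 invariances)] -/
theorem profile_eq_of_map {κ' F' : Type*} [Field F'] [DecidableEq κ'] (e' : ι → κ')
    (f : MvPolynomial κ F →+* MvPolynomial κ' F') (hf : Function.Injective f)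
    (n : ℕ) (ω : Rel ι κ F) (ω' : Rel ι κ' F')
    (h : hsMatrix e' q n ω' = (hsMatrix e q n ω).map f) :
    profile e' q n ω' = profile e q n ω := by
  unfold profile
  rw [h]
  exact rank_map_fractionRing_eq_of_map f hf _

/-! ### MONOMIALS: the profile of `c · t^N` -/

/-- The HS matrix of a constant monomial `c · t^N`: row `T` has the single entry `C(N,T) · c` in
column `N − T` (MIZUTANI-PROOF-g59 §1.4 MONOMIALS). [cite: EGAIV4, Thm. 16.11.2 (16.11.2.1)] -/
theorem hsMatrix_monomial_C (he : Function.Injective e) (n : ℕ) (N : Box ι q) (c : F)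
    (T : {T : Box ι q // T.deg ≤ n}) (M : Box ι q) :
    hsMatrix e q n (monomial N.toF (C c)) T M =
      if M.toF = N.toF - T.1.toF then C ((mchoose N.toF T.1.toF : F) * c) else 0 := by
  rw [hsMatrix_apply, hsOp_monomial_C e he, coeff_monomial]
  by_cases h : M.toF = N.toF - T.1.toF
  · rw [if_pos h.symm, if_pos h]
  · rw [if_neg (fun h' => h h'.symm), if_neg h]

open scoped Classical in
/-- **MONOMIALS, lower bound** (MIZUTANI-PROOF-g59 §1.4): for a constant `c ≠ 0` and `N` in the
box, `σ_n(c · t^N) ≥ #{T ∈ Box : |T| ≤ n, C(N,T) ≠ 0 in F}`; the witnessing minor is the diagonal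
one on these rows and the columns `N − T`.
[cite: Mizutani1973HironakaGroupSchemes, Remark 2.10 (in-house proof, §1.4 MONOMIALS)] -/
theorem card_le_profile_monomial (he : Function.Injective e) (n : ℕ) (N : Box ι q) {c : F}
    (hc : c ≠ 0) :
    (Finset.univ.filter fun T : Box ι q => T.deg ≤ n ∧ (mchoose N.toF T.toF : F) ≠ 0).card ≤
      profile e q n (monomial N.toF (C c)) := by
  classical
  set S := Finset.univ.filter fun T : Box ι q => T.deg ≤ n ∧ (mchoose N.toF T.toF : F) ≠ 0
    with hS
  set r := S.card with hr
  let en : Fin r ≃ {T // T ∈ S} := S.equivFin.symm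
  have hmem : ∀ j : Fin r, ((en j).1).deg ≤ n ∧ (mchoose N.toF (en j).1.toF : F) ≠ 0 := fun j =>
    (Finset.mem_filter.mp (en j).2).2
  -- rows: the elements of `S`; columns: `N − T`
  let rows : Fin r → {T : Box ι q // T.deg ≤ n} := fun j => ⟨(en j).1, (hmem j).1⟩
  let cols : Fin r → Box ι q := fun j => Box.ofF (N.toF - (en j).1.toF) (inBox_tsub N.inBox_toF _)
  rw [le_profile_iff]
  refine ⟨rows, cols, ?_⟩
  -- the submatrix is diagonal with non-zero diagonal entries
  have hle : ∀ j : Fin r, (en j).1.toF ≤ N.toF := fun j => by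
    by_contra hnle
    exact (hmem j).2 (by rw [mchoose_eq_zero_of_not_le hnle, Nat.cast_zero])
  have hdiag : (hsMatrix e q n (monomial N.toF (C c))).submatrix rows cols =
      Matrix.diagonal fun j => C ((mchoose N.toF (en j).1.toF : F) * c) := by
    ext j j'
    rw [Matrix.submatrix_apply, hsMatrix_monomial_C e q he, Matrix.diagonal_apply]
    simp only [rows, cols, Box.toF_ofF]
    by_cases hjj : j = j'
    · subst hjj
      rw [if_pos rfl, if_pos rfl]
    · have hne : ¬ N.toF - (en j').1.toF = N.toF - (en j).1.toF := by
        intro h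
        apply hjj
        have h2 : (en j').1.toF = (en j).1.toF := by
          have := congrArg (fun x => N.toF - x) h
          simp only [tsub_tsub_cancel_of_le (hle j), tsub_tsub_cancel_of_le (hle j')] at this
          exact this
        have h3 : (en j').1 = (en j).1 := Box.toF_injective h2
        exact en.injective (Subtype.ext h3).symm
      rw [if_neg hne, if_neg hjj]
  rw [hdiag, Matrix.det_diagonal]
  refine Finset.prod_ne_zero_iff.mpr fun j _ => ?_
  rw [Ne, ← map_zero (C : F →+* MvPolynomial κ F), C_inj]
  exact mul_ne_zero (hmem j).2 hc

end Profile

end Summit.ResolutionOfSingularities.KangarooAtlas.Mizutani
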